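import Mathlib
import Literature.MathematicalPhysics.QuantumFieldTheory.Luscher2010.TrivializingMaps
import Literature.MathematicalPhysics.QuantumFieldTheory.Luscher2010.FlowActionSeries
import Summits.Ventures.LatticeQCDFlow.TrivializingMaps.PoissonSolver
import Summits.Ventures.LatticeQCDFlow.TrivializingMaps.LoopActionSeries
import HarnessLib

/-!
# The constants of a Lüscher series are the Haar cumulants of the action (eq. (4.9) order by order)

HONEST FRAMING: exact (Metropolis-corrected) sampling algorithms for lattice gauge theory; figures of merit are
autocorrelation/cost numbers at stated couplings and volumes; no continuum-physics claim.

Lüscher, CMP 293 (2010) 899, §4.2 eq. (4.9): the field-independent term of the flow equation is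
`Ċ_t = -(1,S)_t/(1,1)_t = -⟨S e^{-tS}⟩/⟨e^{-tS}⟩` (Haar means), i.e. `Ċ_t = (d/dt) log ⟨e^{-tS}⟩`: the
constants `Ċ^{(k)}` of the series are, up to signs and factorials, the CUMULANTS of `S` under the product Haar
measure. This file proves the statement ORDER BY ORDER for EVERY smooth solution of the recursion
(4.12)–(4.15) (`IsLuscherSeries`) of any smooth action `S`, with no analytic input beyond Green's identity:

* `IsLuscherSeries.const_moment_identity`: for every `N`,
  `∑_{m=0}^{N} (-1)^{N-m} Ċ^{(N-m)} ⟨S^m⟩ / m! = -⟨S^{N+1}⟩ / N!` — the coefficient of `t^N` in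
  `Ċ_t · ⟨e^{-tS}⟩ = -⟨S e^{-tS}⟩`;
* `IsLuscherSeries.const_zero_eq`: `Ċ^{(0)} = -⟨S⟩`; `IsLuscherSeries.const_one_eq`: `Ċ^{(1)} = ⟨S²⟩ - ⟨S⟩²`
  (the variance).

Proof: pair the recursion with `S^j` and integrate. Green's identity (`integral_mul_linkLap`) and the chain
rule `∂(S^{j+1}) = (j+1) S^j ∂S` give `∫ S^j ∑∂S∂S̃^{(k)} = (j+1)⁻¹ ∫ S^{j+1} Δ S̃^{(k)}`, so the numbers
`F(j,k) = (-1)^k ∫ S^j Δ S̃^{(k)} / j!` satisfy `F(j,k+1) = F(j+1,k) + (-1)^{k+1} Ċ^{(k+1)} ⟨S^j⟩/j!`, with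
`F(0,k) = 0` (`∫ Δ = 0`) and `F(j,0) = (⟨S^{j+1}⟩ + Ċ^{(0)}⟨S^j⟩)/j!`; telescoping along `j + k = N` gives the
identity. (THEORY-1 §15, FACT N2: "the constants are physical, not junk".)

References: M. Lüscher, CMP 293 (2010) 899 [Luscher2010Trivializing, arXiv:0907.5491], §4.2 eqs. (4.5)–(4.9),
§4.3 eqs. (4.12)–(4.15).
-/

namespace Summit.Ventures.LatticeQCDFlow.TrivializingMaps

open MeasureTheory
open Literature.MathematicalPhysics.QuantumFieldTheory
open Literature.MathematicalPhysics.QuantumFieldTheory.Luscher2010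
open scoped Matrix Matrix.Norms.Frobenius ContDiff Nat

noncomputable section

variable {d L n : ℕ} [NeZero L]

/-! ## §1. Calculus: `Δ` of a smooth functional is smooth; `∂(S^{j+1}) = (j+1) S^j ∂S` -/

/-- `Δ f` is smooth for smooth `f`. [folklore] -/
theorem contDiff_linkLap (B : SuBasis n) {f : AmbConfig d L n → ℝ} (hf : ContDiff ℝ ∞ f) :
    ContDiff ℝ ∞ (linkLap B f) := by
  have h : linkLap B f = fun W => -∑ e : Edge d L, ∑ a : B.ι,
      linkDeriv e (B.T a) (linkDeriv e (B.T a) f) W := rfl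
  rw [h]
  exact ContDiff.neg (ContDiff.sum fun e _ => ContDiff.sum fun a _ =>
    contDiff_linkDeriv (contDiff_linkDeriv hf e (B.T a)) e (B.T a))

/-- **Chain rule for powers**: `∂_{e,X}(S^{j+1}) = (j+1) S^j ∂_{e,X} S` for differentiable `S`.
[cite: Luscher2010Trivializing, App. A eq. (A.3)] -/
theorem linkDeriv_pow_succ {S : AmbConfig d L n → ℝ} (hS : Differentiable ℝ S) (e : Edge d L)
    (X : Matrix (Fin n) (Fin n) ℂ) : ∀ (j : ℕ) (W : AmbConfig d L n),
    linkDeriv e X (fun W' => S W' ^ (j + 1)) W = (j + 1 : ℝ) * S W ^ j * linkDeriv e X S W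
  | 0, W => by
      have h : (fun W' => S W' ^ (0 + 1)) = S := funext fun W' => by rw [zero_add, pow_one]
      rw [h]; simp
  | j + 1, W => by
      have h : (fun W' => S W' ^ (j + 1 + 1)) = fun W' => S W' * S W' ^ (j + 1) :=
        funext fun W' => by rw [pow_succ']
      have hg : DifferentiableAt ℝ (fun W' => S W' ^ (j + 1)) W := (hS.pow (j + 1)) W
      rw [h, linkDeriv_mul_of_differentiableAt e X (hS W) hg, linkDeriv_pow_succ hS e X j W]
      push_cast
      ring

/-! ## §2. Pairing the recursion with powers of the action -/

section Pairing

variable (B : SuBasis n) {S : AmbConfig d L n → ℝ}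

/-- Continuity on `SU(n)^E` of a smooth ambient functional composed with `ι`. [folklore] -/
private theorem cont_coe {f : AmbConfig d L n → ℝ} (hf : ContDiff ℝ ∞ f) :
    Continuous fun U : GaugeConfig d L (Matrix.specialUnitaryGroup (Fin n) ℂ) => f (WilsonFlow.coeConfig U) :=
  hf.continuous.comp WilsonFlow.continuous_coeConfig

/-- **Green with a power weight**: `∫ S^j ∑_{e,a} ∂^a_e S ∂^a_e f = (j+1)⁻¹ ∫ S^{j+1} Δ f` for smooth `S, f`
(`∑_a S^j ∂S ∂f = (j+1)⁻¹ ∑_a ∂(S^{j+1}) ∂f`, then Green's identity). [cite: Luscher2010Trivializing, §4.2 eq. (4.8)] -/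
theorem integral_pow_mul_bilinear (hS : ContDiff ℝ ∞ S) {f : AmbConfig d L n → ℝ} (hf : ContDiff ℝ ∞ f)
    (j : ℕ) :
    ∫ U, S (WilsonFlow.coeConfig U) ^ j * ∑ e : Edge d L, ∑ a : B.ι,
        linkDeriv e (B.T a) S (WilsonFlow.coeConfig U) * linkDeriv e (B.T a) f (WilsonFlow.coeConfig U)
        ∂(trivialMeasure (Matrix.specialUnitaryGroup (Fin n) ℂ) d L) =
      ((j : ℝ) + 1)⁻¹ * ∫ U, S (WilsonFlow.coeConfig U) ^ (j + 1) * linkLap B f (WilsonFlow.coeConfig U)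
        ∂(trivialMeasure (Matrix.specialUnitaryGroup (Fin n) ℂ) d L) := by
  have hG := integral_mul_linkLap B (hS.pow (j + 1)) hf
  have hD := hS.differentiable (by simp)
  simp only [linkDeriv_pow_succ hD] at hG
  -- each summand: `∫ (j+1) S^j ∂S ∂f = (j+1) ∫ S^j ∂S ∂f`
  have hterm : ∀ (e : Edge d L) (a : B.ι),
      ∫ U, ((j : ℝ) + 1) * S (WilsonFlow.coeConfig U) ^ j * linkDeriv e (B.T a) S (WilsonFlow.coeConfig U) *
          linkDeriv e (B.T a) f (WilsonFlow.coeConfig U)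
          ∂(trivialMeasure (Matrix.specialUnitaryGroup (Fin n) ℂ) d L) =
        ((j : ℝ) + 1) * ∫ U, S (WilsonFlow.coeConfig U) ^ j * (linkDeriv e (B.T a) S (WilsonFlow.coeConfig U) *
          linkDeriv e (B.T a) f (WilsonFlow.coeConfig U))
          ∂(trivialMeasure (Matrix.specialUnitaryGroup (Fin n) ℂ) d L) := by
    intro e a
    rw [← integral_const_mul]
    refine integral_congr_ae (Filter.Eventually.of_forall fun U => ?_)
    simp only
    ring
  have hi : ∀ (e : Edge d L) (a : B.ι), Integrable
      (fun U : GaugeConfig d L (Matrix.specialUnitaryGroup (Fin n) ℂ) =>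
        S (WilsonFlow.coeConfig U) ^ j * (linkDeriv e (B.T a) S (WilsonFlow.coeConfig U) *
          linkDeriv e (B.T a) f (WilsonFlow.coeConfig U)))
      (trivialMeasure (Matrix.specialUnitaryGroup (Fin n) ℂ) d L) := fun e a =>
    integrable_trivialMeasure_of_continuous (((cont_coe hS).pow j).mul
      ((cont_coe (contDiff_linkDeriv hS e (B.T a))).mul (cont_coe (contDiff_linkDeriv hf e (B.T a)))))
  -- the left-hand side as a double sum of integrals
  have hL : ∫ U, S (WilsonFlow.coeConfig U) ^ j * ∑ e : Edge d L, ∑ a : B.ι,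
        linkDeriv e (B.T a) S (WilsonFlow.coeConfig U) * linkDeriv e (B.T a) f (WilsonFlow.coeConfig U)
        ∂(trivialMeasure (Matrix.specialUnitaryGroup (Fin n) ℂ) d L) =
      ∑ e : Edge d L, ∑ a : B.ι, ∫ U, S (WilsonFlow.coeConfig U) ^ j *
        (linkDeriv e (B.T a) S (WilsonFlow.coeConfig U) * linkDeriv e (B.T a) f (WilsonFlow.coeConfig U))
        ∂(trivialMeasure (Matrix.specialUnitaryGroup (Fin n) ℂ) d L) := by
    simp_rw [Finset.mul_sum]
    rw [integral_finsetSum _ fun e _ => integrable_finsetSum _ fun a _ => hi e a]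
    exact Finset.sum_congr rfl fun e _ => integral_finsetSum _ fun a _ => hi e a
  rw [hL, hG]
  simp_rw [hterm, ← Finset.mul_sum]
  have hj : ((j : ℝ) + 1) ≠ 0 := by positivity
  rw [← mul_assoc, inv_mul_cancel₀ hj, one_mul]

variable {Sk : ℕ → AmbConfig d L n → ℝ} {c : ℕ → ℝ}

/-- Order zero paired with `S^j`: `∫ S^j Δ S̃^{(0)} = ⟨S^{j+1}⟩ + Ċ^{(0)} ⟨S^j⟩`.
[cite: Luscher2010Trivializing, §4.3 eq. (4.12)] -/
theorem IsLuscherSeries.integral_pow_mul_linkLap_zero (h : IsLuscherSeries B S Sk c) (hS : ContDiff ℝ ∞ S)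
    (j : ℕ) :
    ∫ U, S (WilsonFlow.coeConfig U) ^ j * linkLap B (Sk 0) (WilsonFlow.coeConfig U)
        ∂(trivialMeasure (Matrix.specialUnitaryGroup (Fin n) ℂ) d L) =
      haarMean (fun W => S W ^ (j + 1)) + c 0 * haarMean (fun W => S W ^ j) := by
  have hpt : ∀ U : GaugeConfig d L (Matrix.specialUnitaryGroup (Fin n) ℂ),
      S (WilsonFlow.coeConfig U) ^ j * linkLap B (Sk 0) (WilsonFlow.coeConfig U) =
        S (WilsonFlow.coeConfig U) ^ (j + 1) + c 0 * S (WilsonFlow.coeConfig U) ^ j := fun U => by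
    rw [h.1 U]; ring
  have hi1 : Integrable (fun U : GaugeConfig d L (Matrix.specialUnitaryGroup (Fin n) ℂ) =>
      S (WilsonFlow.coeConfig U) ^ (j + 1)) (trivialMeasure (Matrix.specialUnitaryGroup (Fin n) ℂ) d L) :=
    integrable_trivialMeasure_of_continuous ((cont_coe hS).pow (j + 1))
  have hi2 : Integrable (fun U : GaugeConfig d L (Matrix.specialUnitaryGroup (Fin n) ℂ) =>
      c 0 * S (WilsonFlow.coeConfig U) ^ j) (trivialMeasure (Matrix.specialUnitaryGroup (Fin n) ℂ) d L) :=
    (integrable_trivialMeasure_of_continuous ((cont_coe hS).pow j)).const_mul (c 0)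
  simp_rw [hpt]
  rw [integral_add hi1 hi2, integral_const_mul]
  rfl

/-- Order `k+1` paired with `S^j`: `∫ S^j Δ S̃^{(k+1)} = -(j+1)⁻¹ ∫ S^{j+1} Δ S̃^{(k)} + Ċ^{(k+1)} ⟨S^j⟩`.
[cite: Luscher2010Trivializing, §4.3 eq. (4.13)] -/
theorem IsLuscherSeries.integral_pow_mul_linkLap_succ (h : IsLuscherSeries B S Sk c) (hS : ContDiff ℝ ∞ S)
    (hsm : ∀ k, ContDiff ℝ ∞ (Sk k)) (j k : ℕ) :
    ∫ U, S (WilsonFlow.coeConfig U) ^ j * linkLap B (Sk (k + 1)) (WilsonFlow.coeConfig U)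
        ∂(trivialMeasure (Matrix.specialUnitaryGroup (Fin n) ℂ) d L) =
      -(((j : ℝ) + 1)⁻¹ * ∫ U, S (WilsonFlow.coeConfig U) ^ (j + 1) * linkLap B (Sk k) (WilsonFlow.coeConfig U)
        ∂(trivialMeasure (Matrix.specialUnitaryGroup (Fin n) ℂ) d L)) + c (k + 1) * haarMean (fun W => S W ^ j) := by
  have hpt : ∀ U : GaugeConfig d L (Matrix.specialUnitaryGroup (Fin n) ℂ),
      S (WilsonFlow.coeConfig U) ^ j * linkLap B (Sk (k + 1)) (WilsonFlow.coeConfig U) =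
        -(S (WilsonFlow.coeConfig U) ^ j * ∑ e : Edge d L, ∑ a : B.ι,
          linkDeriv e (B.T a) S (WilsonFlow.coeConfig U) * linkDeriv e (B.T a) (Sk k) (WilsonFlow.coeConfig U)) +
        c (k + 1) * S (WilsonFlow.coeConfig U) ^ j := fun U => by
    rw [h.2 k U]; ring
  have hc1 : Continuous fun U : GaugeConfig d L (Matrix.specialUnitaryGroup (Fin n) ℂ) =>
      S (WilsonFlow.coeConfig U) ^ j * ∑ e : Edge d L, ∑ a : B.ι,
        linkDeriv e (B.T a) S (WilsonFlow.coeConfig U) * linkDeriv e (B.T a) (Sk k) (WilsonFlow.coeConfig U) :=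
    ((cont_coe hS).pow j).mul (continuous_finsetSum _ fun e _ => continuous_finsetSum _ fun a _ =>
      (cont_coe (contDiff_linkDeriv hS e (B.T a))).mul (cont_coe (contDiff_linkDeriv (hsm k) e (B.T a))))
  have hi1 : Integrable (fun U : GaugeConfig d L (Matrix.specialUnitaryGroup (Fin n) ℂ) =>
      -(S (WilsonFlow.coeConfig U) ^ j * ∑ e : Edge d L, ∑ a : B.ι,
        linkDeriv e (B.T a) S (WilsonFlow.coeConfig U) * linkDeriv e (B.T a) (Sk k) (WilsonFlow.coeConfig U)))
      (trivialMeasure (Matrix.specialUnitaryGroup (Fin n) ℂ) d L) :=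
    (integrable_trivialMeasure_of_continuous hc1).neg
  have hi2 : Integrable (fun U : GaugeConfig d L (Matrix.specialUnitaryGroup (Fin n) ℂ) =>
      c (k + 1) * S (WilsonFlow.coeConfig U) ^ j) (trivialMeasure (Matrix.specialUnitaryGroup (Fin n) ℂ) d L) :=
    (integrable_trivialMeasure_of_continuous ((cont_coe hS).pow j)).const_mul (c (k + 1))
  simp_rw [hpt]
  rw [integral_add hi1 hi2, integral_neg, integral_const_mul, integral_pow_mul_bilinear B hS (hsm k) j]
  rfl

/-- **The telescoping law.** With `F(j,k) = (-1)^k ∫ S^j Δ S̃^{(k)} / j!`: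
`F(j,k) = F(j+k,0) + ∑_{m<k} (-1)^{k-m} Ċ^{(k-m)} ⟨S^{j+m}⟩/(j+m)!`. [cite: Luscher2010Trivializing, §4.2 eq. (4.9)] -/
theorem IsLuscherSeries.telescope (h : IsLuscherSeries B S Sk c) (hS : ContDiff ℝ ∞ S)
    (hsm : ∀ k, ContDiff ℝ ∞ (Sk k)) : ∀ (k j : ℕ),
    (-1 : ℝ) ^ k * (∫ U, S (WilsonFlow.coeConfig U) ^ j * linkLap B (Sk k) (WilsonFlow.coeConfig U)
        ∂(trivialMeasure (Matrix.specialUnitaryGroup (Fin n) ℂ) d L)) / ((j)! : ℝ) =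
      (∫ U, S (WilsonFlow.coeConfig U) ^ (j + k) * linkLap B (Sk 0) (WilsonFlow.coeConfig U)
        ∂(trivialMeasure (Matrix.specialUnitaryGroup (Fin n) ℂ) d L)) / ((j + k)! : ℝ) +
      ∑ m ∈ Finset.range k, (-1 : ℝ) ^ (k - m) * c (k - m) * haarMean (fun W => S W ^ (j + m)) /
        ((j + m)! : ℝ)
  | 0, j => by simp
  | k + 1, j => by
      have ih := IsLuscherSeries.telescope h hS hsm k (j + 1)
      have e1 : j + 1 + k = j + (k + 1) := by omega
      rw [e1] at ih
      have hfac : ((j + 1)! : ℝ) = ((j : ℝ) + 1) * ((j)! : ℝ) := by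
        rw [Nat.factorial_succ]; push_cast; ring
      have hj : ((j : ℝ) + 1) ≠ 0 := by positivity
      have hj' : ((j)! : ℝ) ≠ 0 := by positivity
      have key : ∀ I Mj : ℝ, (-1 : ℝ) ^ (k + 1) * (-((((j : ℝ) + 1)⁻¹ * I)) + c (k + 1) * Mj) / ((j)! : ℝ) =
          (-1 : ℝ) ^ k * I / ((j + 1)! : ℝ) + (-1 : ℝ) ^ (k + 1) * c (k + 1) * Mj / ((j)! : ℝ) := by
        intro I Mj
        rw [hfac, pow_succ]
        field_simp
        ring
      have hsum : ∑ m ∈ Finset.range k, (-1 : ℝ) ^ (k - m) * c (k - m) *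
            haarMean (fun W => S W ^ (j + 1 + m)) / ((j + 1 + m)! : ℝ) =
          ∑ m ∈ Finset.range k, (-1 : ℝ) ^ (k + 1 - (m + 1)) * c (k + 1 - (m + 1)) *
            haarMean (fun W => S W ^ (j + (m + 1))) / ((j + (m + 1))! : ℝ) := by
        refine Finset.sum_congr rfl fun m _ => ?_
        rw [show k + 1 - (m + 1) = k - m by omega, show j + (m + 1) = j + 1 + m by omega]
      rw [IsLuscherSeries.integral_pow_mul_linkLap_succ B h hS hsm j k, key, ih, hsum, Finset.sum_range_succ']
      simp only [Nat.sub_zero, Nat.add_zero]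
      ring

end Pairing

/-! ## §3. The cumulant identities -/

variable {B : SuBasis n} {S : AmbConfig d L n → ℝ} {Sk : ℕ → AmbConfig d L n → ℝ} {c : ℕ → ℝ}

/-- **Lüscher's eq. (4.9) order by order**: for every smooth solution of the recursion (4.12)–(4.15) of a
smooth action `S`, and every `N`,
`∑_{m=0}^{N} (-1)^{N-m} Ċ^{(N-m)} ⟨S^m⟩/m! = -⟨S^{N+1}⟩/N!` — the coefficient of `t^N` in
`Ċ_t ⟨e^{-tS}⟩ = -⟨S e^{-tS}⟩`: the constants are the Haar cumulants of the action,
`∑_k t^k Ċ^{(k)} = (d/dt) log ⟨e^{-tS}⟩` as formal power series. [cite: Luscher2010Trivializing, §4.2 eq. (4.9)] -/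
theorem IsLuscherSeries.const_moment_identity (h : IsLuscherSeries B S Sk c) (hS : ContDiff ℝ ∞ S)
    (hsm : ∀ k, ContDiff ℝ ∞ (Sk k)) (N : ℕ) :
    ∑ m ∈ Finset.range (N + 1), (-1 : ℝ) ^ (N - m) * c (N - m) * haarMean (fun W => S W ^ m) / ((m)! : ℝ) =
      -haarMean (fun W => S W ^ (N + 1)) / ((N)! : ℝ) := by
  have ht := IsLuscherSeries.telescope B h hS hsm N 0
  have h0 : ∫ U, S (WilsonFlow.coeConfig U) ^ 0 * linkLap B (Sk N) (WilsonFlow.coeConfig U)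
      ∂(trivialMeasure (Matrix.specialUnitaryGroup (Fin n) ℂ) d L) = 0 := by
    simp_rw [pow_zero, one_mul]
    exact integral_linkLap_eq_zero B (hsm N)
  rw [h0, mul_zero, zero_div, zero_add, IsLuscherSeries.integral_pow_mul_linkLap_zero B h hS] at ht
  simp only [zero_add] at ht
  rw [Finset.sum_range_succ, Nat.sub_self, pow_zero, one_mul]
  have hsplit : (haarMean (fun W => S W ^ (N + 1)) + c 0 * haarMean (fun W => S W ^ N)) / ((N)! : ℝ) =
      haarMean (fun W => S W ^ (N + 1)) / ((N)! : ℝ) + c 0 * haarMean (fun W => S W ^ N) / ((N)! : ℝ) := by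
    ring
  rw [hsplit] at ht
  linear_combination (-1 : ℝ) * ht

/-- **`Ċ^{(0)} = -⟨S⟩`**: the order-zero constant of every smooth Lüscher series is minus the Haar mean of the
action. [cite: Luscher2010Trivializing, §4.2 eq. (4.9), §4.3 eq. (4.14)] -/
theorem IsLuscherSeries.const_zero_eq (h : IsLuscherSeries B S Sk c) (hS : ContDiff ℝ ∞ S)
    (hsm : ∀ k, ContDiff ℝ ∞ (Sk k)) : c 0 = -haarMean S := by
  have h0 := integral_linkLap_eq_zero B (hsm 0)
  simp_rw [h.1] at h0
  have hi : Integrable (fun U : GaugeConfig d L (Matrix.specialUnitaryGroup (Fin n) ℂ) => S (WilsonFlow.coeConfig U))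
      (trivialMeasure (Matrix.specialUnitaryGroup (Fin n) ℂ) d L) :=
    integrable_trivialMeasure_of_continuous (hS.continuous.comp WilsonFlow.continuous_coeConfig)
  rw [integral_add hi (integrable_const _), integral_const] at h0
  simp only [probReal_univ, one_smul] at h0
  unfold haarMean
  linarith

/-- **`Ċ^{(1)} = ⟨S²⟩ - ⟨S⟩²`**: the order-one constant of every smooth Lüscher series is the Haar variance of
the action. [cite: Luscher2010Trivializing, §4.2 eq. (4.9), §4.4 eq. (4.17)] -/
theorem IsLuscherSeries.const_one_eq (h : IsLuscherSeries B S Sk c) (hS : ContDiff ℝ ∞ S)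
    (hsm : ∀ k, ContDiff ℝ ∞ (Sk k)) :
    c 1 = haarMean (fun W => S W ^ 2) - haarMean S ^ 2 := by
  have h1 := IsLuscherSeries.const_moment_identity h hS hsm 1
  rw [Finset.sum_range_succ, Finset.sum_range_succ, Finset.sum_range_zero, zero_add] at h1
  have hM0 : haarMean (fun W : AmbConfig d L n => S W ^ 0) = 1 := by simp [haarMean]
  have hM1 : haarMean (fun W : AmbConfig d L n => S W ^ 1) = haarMean S := by simp only [pow_one]
  rw [hM0, hM1, IsLuscherSeries.const_zero_eq h hS hsm] at h1
  norm_num at h1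
  linear_combination (-1 : ℝ) * h1

end

end Summit.Ventures.LatticeQCDFlow.TrivializingMaps
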